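import Mathlib
import Summits.AtomisticToContinuum.Crystallization.Theses.LaminarSixThreeThree

/-!
# Route LaminarSixThreeThree — item `Assembly` (stmt-AtomisticToContinuum-13723)

The assembly item of route `LaminarSixThreeThree` (sub-problem `Crystallization` of the summit
`AtomisticToContinuum`) is the implication over the ten load-bearing items of the route, in the
order the deciding theorem `Theses.LaminarSixThreeThree.closes` consumes them:

  `LjLaminarity → LaminarSaturation → LaminarRigidity → StackingFaultSparsity → LaminarToBarlow →
   BarlowToHcpWindows → HcpWindowsToPeriodicWindows → HullCriterion → CrysPeriodicMinAttained →
   CrysEnergyLimit → Crystallization`.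

Pure logic, the same script as `closes` minus its four unused hypotheses:

* the glue `LaminarToBarlow` applied to the three laminar cruxes `LjLaminarity`,
  `LaminarSaturation`, `LaminarRigidity` gives the target `X = LaminarBarlowWindows`;
* `BarlowToHcpWindows` applied to `X` and `StackingFaultSparsity` gives eventual hcp windows,
  `HcpWindowsToPeriodicWindows` turns them into the hinge `PeriodicWindows`, and `HullCriterion`
  gives `IsCrystallizing lennardJones 3` — conjunct (ii) of `Crystallization`;
* `CrysPeriodicMinAttained` gives a least periodic configuration `P`, and `IsLeast.csInf_eq`
  rewrites the limit `⨅_Q e(Q)` of `CrysEnergyLimit` as `e(P)`, i.e.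
  `HasPeriodicGroundStateEnergy lennardJones 3` — conjunct (i).

`_root_.Crystallization` is by `abbrev` the Literature statement
`HasPeriodicGroundStateEnergy lennardJones 3 ∧ IsCrystallizing lennardJones 3`.
Nothing else is proved here; the ten hypotheses remain the route's items.
-/

namespace Summit.AtomisticToContinuum.Crystallization.Theorems

open Summit.AtomisticToContinuum.Crystallization.Theses.LaminarSixThreeThree

/-- **Item `Assembly`** (stmt-AtomisticToContinuum-13723, route LaminarSixThreeThree, rev 1):
the ten load-bearing binders `LjLaminarity`, `LaminarSaturation`, `LaminarRigidity`,
`StackingFaultSparsity`, `LaminarToBarlow`, `BarlowToHcpWindows`, `HcpWindowsToPeriodicWindows`,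
`HullCriterion`, `CrysPeriodicMinAttained`, `CrysEnergyLimit` imply `Crystallization`:
`LaminarToBarlow` fed with the three laminar cruxes gives `LaminarBarlowWindows`; with
`StackingFaultSparsity`, `BarlowToHcpWindows`, `HcpWindowsToPeriodicWindows` and `HullCriterion`
this is the positional conjunct `IsCrystallizing lennardJones 3`; the energetic conjunct is
`CrysEnergyLimit` with its limit `⨅_Q e(Q)` rewritten as `e(P)` for the least periodic
configuration `P` of `CrysPeriodicMinAttained` (`IsLeast.csInf_eq`). [folklore] -/
theorem laminarSixThreeThree_assembly_proof :
    Summit.AtomisticToContinuum.Crystallization.Theses.LaminarSixThreeThree.Assembly := by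
  unfold Assembly
  intro hLam hSat hRig hS hLB hBH hHP hHull hMin hLim
  -- conjunct (ii): X from the three laminar cruxes through the glue, then hcp windows,
  -- the periodic-windows hinge and the hull criterion.
  have hX : LaminarBarlowWindows := hLB hLam hSat hRig
  refine ⟨?_, hHull (hHP (hBH hX hS))⟩
  -- conjunct (i): the attained periodic minimum is the infimum.
  obtain ⟨P, hP⟩ := hMin
  refine ⟨P, hP, ?_⟩
  have h : (⨅ Q : Literature.MathematicalPhysics.StatisticalMechanics.PeriodicConfiguration 3,
      Q.energyPerParticle Literature.MathematicalPhysics.StatisticalMechanics.lennardJones) =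
      P.energyPerParticle Literature.MathematicalPhysics.StatisticalMechanics.lennardJones :=
    hP.csInf_eq
  unfold CrysEnergyLimit at hLim
  rw [h] at hLim
  exact hLim

end Summit.AtomisticToContinuum.Crystallization.Theorems
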